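import Summits.QuantumFields.YangMills.Theorems.UnitScaleTiltProp7SymAvgJointAnalytic
import Summits.QuantumFields.YangMills.Theorems.UnitScaleTiltProp7SymFrameAnalytic
import HarnessLib

/-!
# Route `UnitScaleTilt`, crux K1 «MinimiserStabilityRegPr» (stmt-QuantumFields-19200), route-R E′ (A′) «HCOW-VIA-Σ» (★★OWNER RULING g28-№13), package P-A2 «JOINT-Σ»,
# row F2″-COV (★p1 g17 NAMER WORD 16 (c)), FILE A — **THE JOINT CHART OF THE COVARIANT DOUBLE-BAR ONE STEP IN (PERTURBATION, BACKGROUND) IS ANALYTIC AND BOUNDED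
# ON A JOINT SUP-BALL, HENCE ITS `A`-DERIVATIVE AT `A = 0` IS LIPSCHITZ IN THE BACKGROUND EXPONENT** (gauge-free, level-`j`, field-generic core of the covariant
# column-sum letter `κ_l` of the one-step linearisation `T_l = Df_l(0)` consumed by ✓`IteratedMapTelescope.l1_iterate_sub_fderiv_zero_le_prod` (px18 g3, F0″-a)).

Cell `ym3-torus`, D-0154 (3c) twin-width seat `ym-routeR-w3` (gen 7).  YM₃ on T³ is a ladder rung (R3), NOT the Clay problem; nothing here is a claim about the stub, the crux,
d = 4 or the mass gap.  `--supports stmt-QuantumFields-19200 --as helper`; count-neutral; def-free.  THE DOUBLE-BAR, ONE-STEP, LEVEL-`j` TWIN OF ★w4-20520 g2's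
✓`…Prop7SymAvgJointAnalytic` (there: the plain `k`-fold (0.4) average from level `0`); the Schwarz lemma §0 of that file is reused by name.

THE PRINT.  [Balaban1985Averaging] (89) p. 31 (double bar `w(c₋)⁻¹·V̄(c)·w(c₊)`, frames (82) recomputed against the background), (125)–(127) p. 36 (linear part = the straight
tube, iterated against the background tower), (150)–(152) p. 40; [Balaban1985Variational] (44) p. 285.  At a CURVED background `V` the linear part is compared with the flat one through
a complexified background exponent `B` (`V = e^{B}` on the two blocks read by the coarse bond, after a block axial gauge), exactly as in the (T2) row of the plain average.

WHAT THIS FILE PROVES (sorry-free, no definition; letters: `x = (A, B) : (PBond P j → 𝔸) × (PBond P j → 𝔸)` with the sup (product) norm, the JOINT FIELD `b ↦ e^{A(b)}e^{B(b)}`,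
the BACKGROUND FIELD `b ↦ e^{B(b)}`, the JOINT DOUBLE-BAR CHART at a level-`(j+1)` bond `c`: `x ↦ log[U̿(e^{B}; e^{A}e^{B})(c)·(Ū(e^{B})(c))⁻¹]` (`U̿ = dbarCovU`, `Ū = emlAvgU`),
`ℓ := (d+2)L`, one-step budget `10⁷·ℓ²·ρ ≤ 1`, `M₁′ := 12·L·ρ`).
* §1 level-`j` bondwise analyticity and reads of the joint ∕ background fields and of their difference (`≤ 5ρ` on `‖x‖ ≤ ρ`).
* §2 TWO-FAMILY analyticity of the twisted stair transporter, of the covariant frame and of the covariant double bar — background AND field analytic in the parameter (the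
  one-family versions with constant background are ✓`Prop7SymFrameBound.analyticAt_coe_tstairU_of_steps`∕`_vframeCovU`∕`_dbarCovU_of_twoBlock`).
* §3 ★`analyticAt_dbarJointChart`, ★`norm_dbarJointChart_le` (`≤ M₁′` by W1 ✓`Prop7SymAvgTwSym.norm_dbarCovU_mul_inv_sub_one_le` + `norm_mlog_le_two_mul`), `dbarJointChart_flat_bg`
  (at `B = 0` the joint chart is the flat double-bar chart `A ↦ log U̿(e^{A})(c)` of ✓`Prop8ChartDoubleBar.dbarAvgU`).
* §4 ★★**`norm_fderiv_dbarSlice_sub_fderiv_flat_le`** — for `‖B₀‖ < ρ∕2` and every `Y`: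
  `‖∂_A|_{0} log[U̿(e^{B₀}; e^{A}e^{B₀})(c)·Ū(e^{B₀})(c)⁻¹]·Y − ∂_A|_{0} log[U̿(e^{A})(c)]·Y‖ ≤ (16M₁′∕ρ²)·‖B₀‖·‖Y‖`, and the differentiability of both slices at `0`.
HONEST SCOPE.  Bookkeeping over landed estimates (Cauchy∕Schwarz on an existing analytic chart); constants crude and L-only.  The covariant linearisation row (gauge + locality +
`mlog_conj`, FILE B) and the column sum (FILE C) are the sibling files; the T³∕`RegPr` reading is FILE D.  Nothing of P-A2, hcoW, E′, EX or the crux is claimed.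

References: T. Bałaban, CMP **98** (1985) 17–51 [Balaban1985Averaging] ((82) p.30, (89) p.31, (121)–(127) p.36, (150)–(152) p.40, Prop. 5 (157) p.42); CMP **102** (1985)
277–309 [Balaban1985Variational] ((44)–(46) p.285); CMP **109** (1987) 249–301 [Balaban1987RG1] ((0.4) p.253).
-/

noncomputable section

open scoped BigOperators
open NormedSpace Metric Set

namespace Summit.QuantumFields.YangMills.Theorems.Prop7DbarJointAnalytic

open Literature.MathematicalPhysics.QuantumFieldTheory.Balaban1983to89
open T4Continuum BlockAveraging AveragingRT ExpMeanLog
open B7Prop1Explicit (expUnit val_expUnit)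
open MatrixLog (mlog mlog_one norm_mlog_le_two_mul)
open B12Average012Analytic (analyticAt_units_inv)
open B10Eq27TorusAxialLog (holT)
open Summit.QuantumFields.YangMills.Theorems.Prop8Chart (loopHolU emlAvgU emlAvgU_one norm_loopHolU_sub_one_lt_one)
open Summit.QuantumFields.YangMills.Theorems.Prop8ChartDoubleBar (dbarAvgU)
open Summit.QuantumFields.YangMills.Theorems.Prop7SymAvgTwSym (tstairU vframeCovU coe_vframeCovU dbarCovU dbarCovU_apply dbarCovU_one
  norm_dbarCovU_mul_inv_sub_one_le)
open Summit.QuantumFields.YangMills.Theorems.Prop7SymFrameBound (norm_tstairU_sub_one_lt_one)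
open Summit.QuantumFields.YangMills.Theorems.Prop7SymAvgRelativeBound (analyticAt_coe_holT_of_steps analyticAt_coe_emlAvgU_of_twoBlock
  norm_fderiv_sub_fderiv_zero_le expUnit_zero' norm_exp_sub_one_le_two_mul_norm)

variable {P : Params} {j : ℕ}
variable {𝔸 : Type*} [NormedRing 𝔸] [NormedAlgebra ℂ 𝔸] [CompleteSpace 𝔸] [NormOneClass 𝔸]
variable {E : Type*} [NormedAddCommGroup E] [NormedSpace ℂ E]

/-! ## §1 The joint field `e^{A}e^{B}` and the background field `e^{B}` at level `j`: bondwise analyticity and reads -/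

omit [NormOneClass 𝔸] in
/-- The bond exponent `x ↦ x.1 b` of the joint variable, exponentiated, is analytic (level `j`). [cite: Balaban1985Averaging, (11)-(12) p.19] -/
theorem analyticAt_coe_expFst (b : PBond P j) (x₀ : (PBond P j → 𝔸) × (PBond P j → 𝔸)) :
    AnalyticAt ℂ (fun x : (PBond P j → 𝔸) × (PBond P j → 𝔸) => ((expUnit (x.1 b) : 𝔸ˣ) : 𝔸)) x₀ := by
  have hlin : AnalyticAt ℂ (fun x : (PBond P j → 𝔸) × (PBond P j → 𝔸) => x.1 b) x₀ :=
    ((ContinuousLinearMap.proj (R := ℂ) (φ := fun _ : PBond P j => 𝔸) b).comp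
      (ContinuousLinearMap.fst ℂ (PBond P j → 𝔸) (PBond P j → 𝔸))).analyticAt x₀
  have hfun : (fun x : (PBond P j → 𝔸) × (PBond P j → 𝔸) => ((expUnit (x.1 b) : 𝔸ˣ) : 𝔸)) = fun x => exp (x.1 b) := by
    funext x; rw [val_expUnit]
  rw [hfun]
  exact AnalyticAt.comp_of_eq (exp_analytic _) hlin rfl

omit [NormOneClass 𝔸] in
/-- Same for the second (background) component (level `j`). [cite: Balaban1985Averaging, (11)-(12) p.19] -/
theorem analyticAt_coe_expSnd (b : PBond P j) (x₀ : (PBond P j → 𝔸) × (PBond P j → 𝔸)) :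
    AnalyticAt ℂ (fun x : (PBond P j → 𝔸) × (PBond P j → 𝔸) => ((expUnit (x.2 b) : 𝔸ˣ) : 𝔸)) x₀ := by
  have hlin : AnalyticAt ℂ (fun x : (PBond P j → 𝔸) × (PBond P j → 𝔸) => x.2 b) x₀ :=
    ((ContinuousLinearMap.proj (R := ℂ) (φ := fun _ : PBond P j => 𝔸) b).comp
      (ContinuousLinearMap.snd ℂ (PBond P j → 𝔸) (PBond P j → 𝔸))).analyticAt x₀
  have hfun : (fun x : (PBond P j → 𝔸) × (PBond P j → 𝔸) => ((expUnit (x.2 b) : 𝔸ˣ) : 𝔸)) = fun x => exp (x.2 b) := by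
    funext x; rw [val_expUnit]
  rw [hfun]
  exact AnalyticAt.comp_of_eq (exp_analytic _) hlin rfl

omit [NormOneClass 𝔸] in
/-- **THE JOINT FIELD `b ↦ e^{A(b)}e^{B(b)}` IS BONDWISE ANALYTIC IN `(A, B)`** (level `j`). [cite: Balaban1985Averaging, (11)-(12) p.19] -/
theorem analyticAt_coe_jointFld (b : PBond P j) (x₀ : (PBond P j → 𝔸) × (PBond P j → 𝔸)) :
    AnalyticAt ℂ (fun x : (PBond P j → 𝔸) × (PBond P j → 𝔸) => ((expUnit (x.1 b) * expUnit (x.2 b) : 𝔸ˣ) : 𝔸)) x₀ := by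
  have hfun : (fun x : (PBond P j → 𝔸) × (PBond P j → 𝔸) => ((expUnit (x.1 b) * expUnit (x.2 b) : 𝔸ˣ) : 𝔸)) =
      fun x => ((expUnit (x.1 b) : 𝔸ˣ) : 𝔸) * ((expUnit (x.2 b) : 𝔸ˣ) : 𝔸) := by
    funext x; rw [Units.val_mul]
  rw [hfun]
  exact (analyticAt_coe_expFst b x₀).mul (analyticAt_coe_expSnd b x₀)

omit [NormOneClass 𝔸] in
/-- **READS OF THE BACKGROUND FIELD**: `‖e^{B(b)} − 1‖ ≤ 5ρ` for `‖(A, B)‖ ≤ ρ ≤ 1∕4` (level `j`). [folklore] -/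
theorem norm_coe_bgFld_sub_one_le {ρ : ℝ} (hρ : ρ ≤ 1 / 4) {x : (PBond P j → 𝔸) × (PBond P j → 𝔸)} (hx : ‖x‖ ≤ ρ) (b : PBond P j) :
    ‖((expUnit (x.2 b) : 𝔸ˣ) : 𝔸) - 1‖ ≤ 5 * ρ := by
  have hB : ‖x.2 b‖ ≤ ρ := (norm_le_pi_norm _ b).trans ((norm_snd_le x).trans hx)
  have hρ0 : 0 ≤ ρ := (norm_nonneg _).trans hB
  rw [val_expUnit]
  have h := norm_exp_sub_one_le_two_mul_norm (X := x.2 b) (by linarith)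
  linarith

omit [NormOneClass 𝔸] in
/-- **READS OF THE JOINT FIELD**: `‖e^{A(b)}e^{B(b)} − 1‖ ≤ 5ρ` for `‖(A, B)‖ ≤ ρ ≤ 1∕4` (level `j`). [folklore] -/
theorem norm_coe_jointFld_sub_one_le {ρ : ℝ} (hρ : ρ ≤ 1 / 4) {x : (PBond P j → 𝔸) × (PBond P j → 𝔸)} (hx : ‖x‖ ≤ ρ) (b : PBond P j) :
    ‖((expUnit (x.1 b) * expUnit (x.2 b) : 𝔸ˣ) : 𝔸) - 1‖ ≤ 5 * ρ := by
  have hA : ‖x.1 b‖ ≤ ρ := (norm_le_pi_norm _ b).trans ((norm_fst_le x).trans hx)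
  have hB : ‖x.2 b‖ ≤ ρ := (norm_le_pi_norm _ b).trans ((norm_snd_le x).trans hx)
  have hρ0 : 0 ≤ ρ := (norm_nonneg _).trans hB
  have ha : ‖exp (x.1 b) - 1‖ ≤ 2 * ρ := (norm_exp_sub_one_le_two_mul_norm (X := x.1 b) (by linarith)).trans (by linarith)
  have hb : ‖exp (x.2 b) - 1‖ ≤ 2 * ρ := (norm_exp_sub_one_le_two_mul_norm (X := x.2 b) (by linarith)).trans (by linarith)
  rw [Units.val_mul, val_expUnit, val_expUnit]
  have e : exp (x.1 b) * exp (x.2 b) - 1 = (exp (x.1 b) - 1) * (exp (x.2 b) - 1) + (exp (x.1 b) - 1) + (exp (x.2 b) - 1) := by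
    noncomm_ring
  rw [e]
  have hprod : ‖(exp (x.1 b) - 1) * (exp (x.2 b) - 1)‖ ≤ 2 * ρ * (2 * ρ) :=
    (norm_mul_le _ _).trans (mul_le_mul ha hb (norm_nonneg _) (by positivity))
  calc _ ≤ ‖(exp (x.1 b) - 1) * (exp (x.2 b) - 1)‖ + ‖exp (x.1 b) - 1‖ + ‖exp (x.2 b) - 1‖ := norm_add₃_le
    _ ≤ 2 * ρ * (2 * ρ) + 2 * ρ + 2 * ρ := by linarith
    _ ≤ 5 * ρ := by nlinarith

/-- **DIFFERENCE READS**: `‖e^{A(b)}e^{B(b)} − e^{B(b)}‖ ≤ 5ρ` for `‖(A, B)‖ ≤ ρ ≤ 1∕4` (`(e^{A} − 1)·e^{B}`, `‖e^{B}‖ ≤ 1 + 5ρ`). [folklore] -/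
theorem norm_coe_jointFld_sub_bgFld_le {ρ : ℝ} (hρ : ρ ≤ 1 / 4) {x : (PBond P j → 𝔸) × (PBond P j → 𝔸)} (hx : ‖x‖ ≤ ρ) (b : PBond P j) :
    ‖((expUnit (x.1 b) * expUnit (x.2 b) : 𝔸ˣ) : 𝔸) - ((expUnit (x.2 b) : 𝔸ˣ) : 𝔸)‖ ≤ 5 * ρ := by
  have hA : ‖x.1 b‖ ≤ ρ := (norm_le_pi_norm _ b).trans ((norm_fst_le x).trans hx)
  have hρ0 : 0 ≤ ρ := (norm_nonneg _).trans hA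
  have ha : ‖exp (x.1 b) - 1‖ ≤ 2 * ρ := (norm_exp_sub_one_le_two_mul_norm (X := x.1 b) (by linarith)).trans (by linarith)
  have hb : ‖((expUnit (x.2 b) : 𝔸ˣ) : 𝔸)‖ ≤ 1 + 5 * ρ := by
    have h1 := norm_coe_bgFld_sub_one_le hρ hx b
    calc ‖((expUnit (x.2 b) : 𝔸ˣ) : 𝔸)‖ = ‖(((expUnit (x.2 b) : 𝔸ˣ) : 𝔸) - 1) + 1‖ := by rw [sub_add_cancel]
      _ ≤ ‖((expUnit (x.2 b) : 𝔸ˣ) : 𝔸) - 1‖ + ‖(1 : 𝔸)‖ := norm_add_le _ _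
      _ ≤ 5 * ρ + 1 := by rw [norm_one]; linarith
      _ = 1 + 5 * ρ := by ring
  have e : ((expUnit (x.1 b) * expUnit (x.2 b) : 𝔸ˣ) : 𝔸) - ((expUnit (x.2 b) : 𝔸ˣ) : 𝔸) =
      (exp (x.1 b) - 1) * ((expUnit (x.2 b) : 𝔸ˣ) : 𝔸) := by
    rw [Units.val_mul, val_expUnit]; noncomm_ring
  rw [e]
  calc ‖(exp (x.1 b) - 1) * ((expUnit (x.2 b) : 𝔸ˣ) : 𝔸)‖ ≤ 2 * ρ * (1 + 5 * ρ) :=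
        (norm_mul_le _ _).trans (mul_le_mul ha hb (norm_nonneg _) (by positivity))
    _ ≤ 5 * ρ := by nlinarith

/-! ## §2 Two-family analyticity: background and field both analytic in the parameter -/

omit [NormOneClass 𝔸] in
/-- **A TWISTED STAIR TRANSPORTER `W(Γ)·U₀(Γ)⁻¹` IS ANALYTIC IN THE PARAMETER AS SOON AS THE BOND VARIABLES OF BOTH FIELDS ON ITS STAIR ARE** (two-family twin of
✓`Prop7SymFrameBound.analyticAt_coe_tstairU_of_steps`). [cite: Balaban1985Averaging, (58) p.27, (82) p.30] -/
theorem analyticAt_coe_tstairU₂ {F G : E → GaugeField P j 𝔸ˣ} {x₀ : E} (y : Site P (j + 1)) (i : Idx P)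
    (hF : ∀ st ∈ walk (emb y) (stairWord i.2.1 (off i.1)), AnalyticAt ℂ (fun x => ((F x st.bond : 𝔸ˣ) : 𝔸)) x₀)
    (hG : ∀ st ∈ walk (emb y) (stairWord i.2.1 (off i.1)), AnalyticAt ℂ (fun x => ((G x st.bond : 𝔸ˣ) : 𝔸)) x₀) :
    AnalyticAt ℂ (fun x => ((tstairU (G x) (F x) y i : 𝔸ˣ) : 𝔸)) x₀ := by
  have h : (fun x => ((tstairU (G x) (F x) y i : 𝔸ˣ) : 𝔸)) = fun x =>
      ((holT (F x) (emb y) (stairWord i.2.1 (off i.1)) : 𝔸ˣ) : 𝔸) * (((holT (G x) (emb y) (stairWord i.2.1 (off i.1)))⁻¹ : 𝔸ˣ) : 𝔸) := by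
    funext x; rw [tstairU, Units.val_mul]
  rw [h]
  exact (analyticAt_coe_holT_of_steps _ _ hF).mul (analyticAt_units_inv (analyticAt_coe_holT_of_steps _ _ hG))

omit [NormOneClass 𝔸] in
/-- **THE COVARIANT FRAME OF A TWO-FAMILY IS ANALYTIC IN THE PARAMETER** as soon as both families are bondwise analytic in the block and the twisted stair transporters at `x₀`
are within `1` of `1` (`ExpMeanLog.analyticAt_eml`). [cite: Balaban1985Averaging, (82) p.30, (62) p.28] -/
theorem analyticAt_coe_vframeCovU₂ (hj : j + 1 ≤ P.m + P.K) {F G : E → GaugeField P j 𝔸ˣ} {x₀ : E} (y : Site P (j + 1))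
    (hF : ∀ b : PBond P j, blockOf b.src = y → blockOf b.tgt = y → AnalyticAt ℂ (fun x => ((F x b : 𝔸ˣ) : 𝔸)) x₀)
    (hG : ∀ b : PBond P j, blockOf b.src = y → blockOf b.tgt = y → AnalyticAt ℂ (fun x => ((G x b : 𝔸ˣ) : 𝔸)) x₀)
    (hnear : ∀ i : Idx P, ‖((tstairU (G x₀) (F x₀) y i : 𝔸ˣ) : 𝔸) - 1‖ < 1) :
    AnalyticAt ℂ (fun x => ((vframeCovU (G x) (F x) y : 𝔸ˣ) : 𝔸)) x₀ := by
  have h : (fun x => ((vframeCovU (G x) (F x) y : 𝔸ˣ) : 𝔸)) = fun x => eml (fun i : Idx P => ((tstairU (G x) (F x) y i : 𝔸ˣ) : 𝔸)) := by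
    funext x; exact coe_vframeCovU (G x) (F x) y
  rw [h]
  have hfam : AnalyticAt ℂ (fun x => fun i : Idx P => ((tstairU (G x) (F x) y i : 𝔸ˣ) : 𝔸)) x₀ :=
    analyticAt_pi_iff.mpr fun i => analyticAt_coe_tstairU₂ y i
      (fun st hst => hF st.bond (blockOf_ends_of_mem_stairWalk hj y i.1 i.2.1 st hst).1 (blockOf_ends_of_mem_stairWalk hj y i.1 i.2.1 st hst).2)
      (fun st hst => hG st.bond (blockOf_ends_of_mem_stairWalk hj y i.1 i.2.1 st hst).1 (blockOf_ends_of_mem_stairWalk hj y i.1 i.2.1 st hst).2)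
  exact AnalyticAt.comp_of_eq (analyticAt_eml hnear) hfam rfl

omit [NormOneClass 𝔸] in
/-- **LOCAL ANALYTICITY OF THE COVARIANT DOUBLE-BAR ONE STEP OF A TWO-FAMILY** `x ↦ U̿(G x; F x)(c) = w(c₋)⁻¹·Ū[F x](c)·w(c₊)` (frames against the VARYING background `G x`):
bondwise analyticity of both families on the two blocks of `c`, loops within `1` of `1`, twisted stairs at both ends within `1` of `1`.
[cite: Balaban1985Averaging, (89) p.31; Balaban1987RG1, (0.4) p.253] -/
theorem analyticAt_coe_dbarCovU₂ (hj : j + 1 ≤ P.m + P.K) {F G : E → GaugeField P j 𝔸ˣ} {x₀ : E} (c : PBond P (j + 1))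
    (hF : ∀ b : PBond P j, (blockOf b.src = c.src ∨ blockOf b.src = c.tgt) → (blockOf b.tgt = c.src ∨ blockOf b.tgt = c.tgt) →
      AnalyticAt ℂ (fun x => ((F x b : 𝔸ˣ) : 𝔸)) x₀)
    (hG : ∀ b : PBond P j, (blockOf b.src = c.src ∨ blockOf b.src = c.tgt) → (blockOf b.tgt = c.src ∨ blockOf b.tgt = c.tgt) →
      AnalyticAt ℂ (fun x => ((G x b : 𝔸ˣ) : 𝔸)) x₀)
    (hloop : ∀ i : Idx P, ‖((loopHolU (F x₀) c i : 𝔸ˣ) : 𝔸) - 1‖ < 1)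
    (hsrc : ∀ i : Idx P, ‖((tstairU (G x₀) (F x₀) c.src i : 𝔸ˣ) : 𝔸) - 1‖ < 1)
    (htgt : ∀ i : Idx P, ‖((tstairU (G x₀) (F x₀) c.tgt i : 𝔸ˣ) : 𝔸) - 1‖ < 1) :
    AnalyticAt ℂ (fun x => ((dbarCovU (G x) (F x) c : 𝔸ˣ) : 𝔸)) x₀ := by
  have h : (fun x => ((dbarCovU (G x) (F x) c : 𝔸ˣ) : 𝔸)) = fun x =>
      (((vframeCovU (G x) (F x) c.src)⁻¹ : 𝔸ˣ) : 𝔸) * ((emlAvgU (F x) c : 𝔸ˣ) : 𝔸) * ((vframeCovU (G x) (F x) c.tgt : 𝔸ˣ) : 𝔸) := by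
    funext x; rw [dbarCovU_apply, Units.val_mul, Units.val_mul]
  rw [h]
  have hs : AnalyticAt ℂ (fun x => ((vframeCovU (G x) (F x) c.src : 𝔸ˣ) : 𝔸)) x₀ :=
    analyticAt_coe_vframeCovU₂ hj c.src (fun b hb1 hb2 => hF b (Or.inl hb1) (Or.inl hb2)) (fun b hb1 hb2 => hG b (Or.inl hb1) (Or.inl hb2)) hsrc
  have ht : AnalyticAt ℂ (fun x => ((vframeCovU (G x) (F x) c.tgt : 𝔸ˣ) : 𝔸)) x₀ :=
    analyticAt_coe_vframeCovU₂ hj c.tgt (fun b hb1 hb2 => hF b (Or.inr hb1) (Or.inr hb2)) (fun b hb1 hb2 => hG b (Or.inr hb1) (Or.inr hb2)) htgt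
  exact ((analyticAt_units_inv hs).mul (analyticAt_coe_emlAvgU_of_twoBlock hj c hF hloop)).mul ht

/-! ## §3 The joint double-bar chart: analytic and bounded on the joint sup-ball -/

/-- Arithmetic of the one-step budget `10⁷·ℓ²·ρ ≤ 1` (`ℓ = (d+2)L ≥ 1`, `L ≤ ℓ`): the windows of the bricks below. [folklore] -/
theorem windows_of_budget {ρ : ℝ} (hρ0 : 0 ≤ ρ) (hbudget : 10000000 * (((P.d + 2) * P.L : ℕ) : ℝ) ^ 2 * ρ ≤ 1) :
    ρ ≤ 1 / 4 ∧ 4 * (((P.d + 2) * P.L : ℕ) : ℝ) * (5 * ρ) < 1 ∧ 16 * (((P.d + 2) * P.L : ℕ) : ℝ) * (5 * ρ) ≤ 1 ∧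
      120 * (((P.d + 2) * P.L : ℕ) : ℝ) * (5 * ρ + 5 * ρ) ≤ 1 ∧
      (P.L : ℝ) * (5 * ρ) + 22100 * (((P.d + 2) * P.L : ℕ) : ℝ) ^ 2 * (5 * ρ + 5 * ρ) ^ 2 ≤ 6 * (P.L : ℝ) * ρ ∧
      6 * (P.L : ℝ) * ρ ≤ 1 / 2 := by
  set ℓ : ℝ := (((P.d + 2) * P.L : ℕ) : ℝ) with hℓ
  have hℓ1 : (1 : ℝ) ≤ ℓ := by
    rw [hℓ]; exact_mod_cast Nat.one_le_iff_ne_zero.mpr (Nat.mul_ne_zero (by omega) (by have := P.hL.2; omega))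
  have hL1 : (1 : ℝ) ≤ (P.L : ℝ) := by exact_mod_cast P.L_pos
  have hLℓ : (P.L : ℝ) ≤ ℓ := by
    rw [hℓ]; push_cast; nlinarith [show (0:ℝ) ≤ (P.d : ℝ) from Nat.cast_nonneg _]
  have hℓρ : ℓ * ρ ≤ ℓ ^ 2 * ρ := by nlinarith [mul_nonneg (by linarith : (0:ℝ) ≤ ℓ) hρ0]
  have h1 : 10000000 * (ℓ ^ 2 * ρ) ≤ 1 := by linarith
  have hLρ : (P.L : ℝ) * ρ ≤ ℓ * ρ := mul_le_mul_of_nonneg_right hLℓ hρ0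
  refine ⟨by nlinarith, by nlinarith, by nlinarith, by nlinarith, ?_, by nlinarith⟩
  have hsq : 22100 * ℓ ^ 2 * (5 * ρ + 5 * ρ) ^ 2 = (2210000 * (ℓ ^ 2 * ρ)) * ρ := by ring
  have h2 : (2210000 * (ℓ ^ 2 * ρ)) * ρ ≤ 1 * ρ := mul_le_mul_of_nonneg_right (by nlinarith) hρ0
  nlinarith

/-- ★ **THE JOINT DOUBLE-BAR CHART IS ANALYTIC ON THE JOINT SUP-BALL**: under the budget `10⁷ℓ²ρ ≤ 1`, at every `x₀ = (A₀, B₀)` with `‖x₀‖ ≤ ρ` the map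
`x ↦ log[U̿(e^{B}; e^{A}e^{B})(c)·(Ū(e^{B})(c))⁻¹]` is analytic (two-family analyticity §2 at the joint∕background fields, loops and twisted stairs within `1` of `1` by the reads,
value within `1` of `1` by W1). [cite: Balaban1985Averaging, (89) p.31, (121)-(125) p.36; Balaban1987RG1, (0.4) p.253] -/
theorem analyticAt_dbarJointChart (hj : j + 1 ≤ P.m + P.K) (c : PBond P (j + 1)) {ρ : ℝ} (hρ0 : 0 ≤ ρ)
    (hbudget : 10000000 * (((P.d + 2) * P.L : ℕ) : ℝ) ^ 2 * ρ ≤ 1)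
    (x₀ : (PBond P j → 𝔸) × (PBond P j → 𝔸)) (hx₀ : ‖x₀‖ ≤ ρ) :
    AnalyticAt ℂ (fun x : (PBond P j → 𝔸) × (PBond P j → 𝔸) =>
      mlog (((dbarCovU (fun b => expUnit (x.2 b)) (fun b => expUnit (x.1 b) * expUnit (x.2 b)) c : 𝔸ˣ) : 𝔸) *
        (((emlAvgU (fun b => expUnit (x.2 b)) c)⁻¹ : 𝔸ˣ) : 𝔸))) x₀ := by
  obtain ⟨hρ4, hloopw, hstairw, hW1w, hW1b, hhalf⟩ := windows_of_budget (P := P) hρ0 hbudget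
  have h5 : 0 ≤ 5 * ρ := by positivity
  have hJr : ∀ b : PBond P j, ‖((expUnit (x₀.1 b) * expUnit (x₀.2 b) : 𝔸ˣ) : 𝔸) - 1‖ ≤ 5 * ρ := fun b => norm_coe_jointFld_sub_one_le hρ4 hx₀ b
  have hBr : ∀ b : PBond P j, ‖((expUnit (x₀.2 b) : 𝔸ˣ) : 𝔸) - 1‖ ≤ 5 * ρ := fun b => norm_coe_bgFld_sub_one_le hρ4 hx₀ b
  have hDr : ∀ b : PBond P j, ‖((expUnit (x₀.1 b) * expUnit (x₀.2 b) : 𝔸ˣ) : 𝔸) - ((expUnit (x₀.2 b) : 𝔸ˣ) : 𝔸)‖ ≤ 5 * ρ :=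
    fun b => norm_coe_jointFld_sub_bgFld_le hρ4 hx₀ b
  -- smallness at `x₀`: loops and twisted stairs within `1` of `1`
  have hloop : ∀ i : Idx P, ‖((loopHolU (fun b => expUnit (x₀.1 b) * expUnit (x₀.2 b)) c i : 𝔸ˣ) : 𝔸) - 1‖ < 1 :=
    fun i => norm_loopHolU_sub_one_lt_one hj c h5 hloopw (fun b _ _ => hJr b) i
  have hloopB : ∀ i : Idx P, ‖((loopHolU (fun b => expUnit (x₀.2 b)) c i : 𝔸ˣ) : 𝔸) - 1‖ < 1 :=
    fun i => norm_loopHolU_sub_one_lt_one hj c h5 hloopw (fun b _ _ => hBr b) i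
  have hsrc : ∀ i : Idx P, ‖((tstairU (fun b => expUnit (x₀.2 b)) (fun b => expUnit (x₀.1 b) * expUnit (x₀.2 b)) c.src i : 𝔸ˣ) : 𝔸) - 1‖ < 1 :=
    fun i => norm_tstairU_sub_one_lt_one hj (fun b => expUnit (x₀.2 b)) (fun b => expUnit (x₀.1 b) * expUnit (x₀.2 b)) c.src h5 hstairw
      (fun b _ _ => hJr b) (fun b _ _ => hBr b) i
  have htgt : ∀ i : Idx P, ‖((tstairU (fun b => expUnit (x₀.2 b)) (fun b => expUnit (x₀.1 b) * expUnit (x₀.2 b)) c.tgt i : 𝔸ˣ) : 𝔸) - 1‖ < 1 :=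
    fun i => norm_tstairU_sub_one_lt_one hj (fun b => expUnit (x₀.2 b)) (fun b => expUnit (x₀.1 b) * expUnit (x₀.2 b)) c.tgt h5 hstairw
      (fun b _ _ => hJr b) (fun b _ _ => hBr b) i
  -- the double bar of the joint field against the background field (two-family analyticity)
  have hJ : AnalyticAt ℂ (fun x : (PBond P j → 𝔸) × (PBond P j → 𝔸) =>
      ((dbarCovU (fun b => expUnit (x.2 b)) (fun b => expUnit (x.1 b) * expUnit (x.2 b)) c : 𝔸ˣ) : 𝔸)) x₀ :=
    analyticAt_coe_dbarCovU₂ (E := (PBond P j → 𝔸) × (PBond P j → 𝔸))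
      (F := fun x b => expUnit (x.1 b) * expUnit (x.2 b)) (G := fun x b => expUnit (x.2 b)) hj c
      (fun b _ _ => analyticAt_coe_jointFld b x₀) (fun b _ _ => analyticAt_coe_expSnd b x₀) hloop hsrc htgt
  -- the single bar of the background field
  have hB : AnalyticAt ℂ (fun x : (PBond P j → 𝔸) × (PBond P j → 𝔸) => ((emlAvgU (fun b => expUnit (x.2 b)) c : 𝔸ˣ) : 𝔸)) x₀ :=
    analyticAt_coe_emlAvgU_of_twoBlock (E := (PBond P j → 𝔸) × (PBond P j → 𝔸)) (F := fun x b => expUnit (x.2 b)) hj c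
      (fun b _ _ => analyticAt_coe_expSnd b x₀) hloopB
  have hprod := hJ.mul (analyticAt_units_inv hB)
  -- the value at `x₀` is within `6Lρ < 1` of `1` (W1)
  have hrel : ‖((dbarCovU (fun b => expUnit (x₀.2 b)) (fun b => expUnit (x₀.1 b) * expUnit (x₀.2 b)) c : 𝔸ˣ) : 𝔸) *
        (((emlAvgU (fun b => expUnit (x₀.2 b)) c)⁻¹ : 𝔸ˣ) : 𝔸) - 1‖ ≤ 6 * (P.L : ℝ) * ρ :=
    (norm_dbarCovU_mul_inv_sub_one_le hj c h5 h5 h5 hW1w (fun b _ _ => hBr b) (fun b _ _ => hJr b) (fun b _ _ => hDr b)).trans hW1b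
  have hlt : 6 * (P.L : ℝ) * ρ < 1 := by linarith
  have hm : AnalyticAt ℂ (mlog : 𝔸 → 𝔸) (((dbarCovU (fun b => expUnit (x₀.2 b)) (fun b => expUnit (x₀.1 b) * expUnit (x₀.2 b)) c : 𝔸ˣ) : 𝔸) *
      (((emlAvgU (fun b => expUnit (x₀.2 b)) c)⁻¹ : 𝔸ˣ) : 𝔸)) := MatrixLog.analyticAt_mlog (hrel.trans_lt hlt)
  exact hm.comp_of_eq hprod rfl

/-- ★ **THE JOINT DOUBLE-BAR CHART IS BOUNDED BY `M₁′ = 12Lρ` ON THE JOINT SUP-BALL** (the relative double bar is within `6Lρ ≤ 1∕2` of `1` by W1, then `|log X| ≤ 2|X − 1|`).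
[cite: Balaban1985Averaging, (89) p.31, (121)-(125) p.36; Balaban1987RG1, (0.4) p.253] -/
theorem norm_dbarJointChart_le (hj : j + 1 ≤ P.m + P.K) (c : PBond P (j + 1)) {ρ : ℝ} (hρ0 : 0 ≤ ρ)
    (hbudget : 10000000 * (((P.d + 2) * P.L : ℕ) : ℝ) ^ 2 * ρ ≤ 1)
    (x : (PBond P j → 𝔸) × (PBond P j → 𝔸)) (hx : ‖x‖ ≤ ρ) :
    ‖mlog (((dbarCovU (fun b => expUnit (x.2 b)) (fun b => expUnit (x.1 b) * expUnit (x.2 b)) c : 𝔸ˣ) : 𝔸) *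
        (((emlAvgU (fun b => expUnit (x.2 b)) c)⁻¹ : 𝔸ˣ) : 𝔸))‖ ≤ 12 * (P.L : ℝ) * ρ := by
  obtain ⟨hρ4, _, _, hW1w, hW1b, hhalf⟩ := windows_of_budget (P := P) hρ0 hbudget
  have h5 : 0 ≤ 5 * ρ := by positivity
  have hJr : ∀ b : PBond P j, ‖((expUnit (x.1 b) * expUnit (x.2 b) : 𝔸ˣ) : 𝔸) - 1‖ ≤ 5 * ρ := fun b => norm_coe_jointFld_sub_one_le hρ4 hx b
  have hBr : ∀ b : PBond P j, ‖((expUnit (x.2 b) : 𝔸ˣ) : 𝔸) - 1‖ ≤ 5 * ρ := fun b => norm_coe_bgFld_sub_one_le hρ4 hx b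
  have hDr : ∀ b : PBond P j, ‖((expUnit (x.1 b) * expUnit (x.2 b) : 𝔸ˣ) : 𝔸) - ((expUnit (x.2 b) : 𝔸ˣ) : 𝔸)‖ ≤ 5 * ρ :=
    fun b => norm_coe_jointFld_sub_bgFld_le hρ4 hx b
  have hrel := (norm_dbarCovU_mul_inv_sub_one_le hj c h5 h5 h5 hW1w (fun b _ _ => hBr b) (fun b _ _ => hJr b) (fun b _ _ => hDr b)).trans hW1b
  calc _ ≤ 2 * ‖((dbarCovU (fun b => expUnit (x.2 b)) (fun b => expUnit (x.1 b) * expUnit (x.2 b)) c : 𝔸ˣ) : 𝔸) *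
        (((emlAvgU (fun b => expUnit (x.2 b)) c)⁻¹ : 𝔸ˣ) : 𝔸) - 1‖ := norm_mlog_le_two_mul (hrel.trans hhalf)
    _ ≤ _ := by linarith

omit [NormOneClass 𝔸] in
/-- **AT `B = 0` THE JOINT DOUBLE-BAR CHART IS THE FLAT DOUBLE-BAR CHART `A ↦ log U̿(e^{A})(c)`** (`e^{0} = 1`, `U̿(1; W) = dbarAvgU W` ✓`dbarCovU_one`, `Ū(1) = 1`).
[cite: Balaban1985Averaging, (89) p.31, (110) p.34] -/
theorem dbarJointChart_flat_bg (c : PBond P (j + 1)) (A : PBond P j → 𝔸) :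
    mlog (((dbarCovU (fun b => expUnit (((A, (0 : PBond P j → 𝔸)) : (PBond P j → 𝔸) × (PBond P j → 𝔸)).2 b))
          (fun b => expUnit (((A, (0 : PBond P j → 𝔸)) : (PBond P j → 𝔸) × (PBond P j → 𝔸)).1 b) *
            expUnit (((A, (0 : PBond P j → 𝔸)) : (PBond P j → 𝔸) × (PBond P j → 𝔸)).2 b)) c : 𝔸ˣ) : 𝔸) *
        (((emlAvgU (fun b => expUnit (((A, (0 : PBond P j → 𝔸)) : (PBond P j → 𝔸) × (PBond P j → 𝔸)).2 b)) c)⁻¹ : 𝔸ˣ) : 𝔸)) =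
      mlog ((dbarAvgU (fun b => expUnit (A b)) c : 𝔸ˣ) : 𝔸) := by
  have h1 : (fun b : PBond P j => expUnit (((A, (0 : PBond P j → 𝔸)) : (PBond P j → 𝔸) × (PBond P j → 𝔸)).1 b) *
      expUnit (((A, (0 : PBond P j → 𝔸)) : (PBond P j → 𝔸) × (PBond P j → 𝔸)).2 b)) = fun b => expUnit (A b) := by
    funext b; simp only [Pi.zero_apply, expUnit_zero', mul_one]
  have h2 : (fun b : PBond P j => expUnit (((A, (0 : PBond P j → 𝔸)) : (PBond P j → 𝔸) × (PBond P j → 𝔸)).2 b)) = fun _ => (1 : 𝔸ˣ) := by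
    funext b; simp only [Pi.zero_apply, expUnit_zero']
  rw [h1, h2, dbarCovU_one, emlAvgU_one]
  simp

/-! ## §4 The `A`-derivative at `A = 0` is Lipschitz in the background exponent -/

/-- ★★ **THE LINEARISED COVARIANT DOUBLE BAR AT THE BACKGROUND `e^{B₀}` VERSUS THE FLAT ONE — LIPSCHITZ IN `B₀`.**  Under the budget `10⁷ℓ²ρ ≤ 1`, `0 < ρ`, for `‖B₀‖ < ρ∕2`
and every `Y`: `‖∂_A|_{0} log[U̿(e^{B₀}; e^{A}e^{B₀})(c)·Ū(e^{B₀})(c)⁻¹]·Y − ∂_A|_{0} log[U̿(e^{A})(c)]·Y‖ ≤ (16M₁′∕ρ²)·‖B₀‖·‖Y‖`, `M₁′ = 12Lρ` (Schwarz §0 of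
✓`…SymAvgJointAnalytic` at the joint chart between `(0, B₀)` and `0`, read on `(Y, 0)`; chain rule through `A ↦ (A, B₀)`).
[cite: Balaban1985Averaging, (125)-(127) p.36, Prop. 5 (157) p.42; Balaban1985Variational, (44)-(46) p.285] -/
theorem norm_fderiv_dbarSlice_sub_fderiv_flat_le (hj : j + 1 ≤ P.m + P.K) (c : PBond P (j + 1)) {ρ : ℝ} (hρ0 : 0 < ρ)
    (hbudget : 10000000 * (((P.d + 2) * P.L : ℕ) : ℝ) ^ 2 * ρ ≤ 1)
    (B₀ : PBond P j → 𝔸) (hB₀ : ‖B₀‖ < ρ / 2) (Y : PBond P j → 𝔸) :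
    ‖fderiv ℂ (fun A : PBond P j → 𝔸 =>
          mlog (((dbarCovU (fun b => expUnit (B₀ b)) (fun b => expUnit (A b) * expUnit (B₀ b)) c : 𝔸ˣ) : 𝔸) *
            (((emlAvgU (fun b => expUnit (B₀ b)) c)⁻¹ : 𝔸ˣ) : 𝔸))) 0 Y -
        fderiv ℂ (fun A : PBond P j → 𝔸 => mlog ((dbarAvgU (fun b => expUnit (A b)) c : 𝔸ˣ) : 𝔸)) 0 Y‖ ≤
      16 * (12 * (P.L : ℝ) * ρ) / ρ ^ 2 * ‖B₀‖ * ‖Y‖ := by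
  -- the joint chart, analytic and bounded on the open ball of radius ρ
  set Ct : (PBond P j → 𝔸) × (PBond P j → 𝔸) → 𝔸 := fun x =>
    mlog (((dbarCovU (fun b => expUnit (x.2 b)) (fun b => expUnit (x.1 b) * expUnit (x.2 b)) c : 𝔸ˣ) : 𝔸) *
      (((emlAvgU (fun b => expUnit (x.2 b)) c)⁻¹ : 𝔸ˣ) : 𝔸)) with hCt
  have han : AnalyticOnNhd ℂ Ct (ball (0 : (PBond P j → 𝔸) × (PBond P j → 𝔸)) ρ) := fun x hx =>
    analyticAt_dbarJointChart hj c hρ0.le hbudget x (mem_ball_zero_iff.1 hx).le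
  have hbd : ∀ x ∈ ball (0 : (PBond P j → 𝔸) × (PBond P j → 𝔸)) ρ, ‖Ct x‖ ≤ 12 * (P.L : ℝ) * ρ :=
    fun x hx => norm_dbarJointChart_le hj c hρ0.le hbudget x (mem_ball_zero_iff.1 hx).le
  -- Schwarz between `(0, B₀)` and `0`
  have hnB : ‖((0 : PBond P j → 𝔸), B₀)‖ = ‖B₀‖ := by simp [Prod.norm_def]
  have hS := norm_fderiv_sub_fderiv_zero_le hρ0 han hbd (Y := ((0 : PBond P j → 𝔸), B₀)) (by rw [hnB]; exact hB₀)
  rw [hnB] at hS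
  -- the two slices through `A ↦ (A, B₀)` and `A ↦ (A, 0)`
  have hmemB : ((0 : PBond P j → 𝔸), B₀) ∈ ball (0 : (PBond P j → 𝔸) × (PBond P j → 𝔸)) ρ := by
    rw [mem_ball_zero_iff, hnB]; linarith
  have hmem0 : ((0 : PBond P j → 𝔸), (0 : PBond P j → 𝔸)) ∈ ball (0 : (PBond P j → 𝔸) × (PBond P j → 𝔸)) ρ := by
    rw [mem_ball_zero_iff]; simp [Prod.norm_def, hρ0]
  have hdB : HasFDerivAt Ct (fderiv ℂ Ct ((0 : PBond P j → 𝔸), B₀)) ((0 : PBond P j → 𝔸), B₀) := (han _ hmemB).differentiableAt.hasFDerivAt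
  have hd0 : HasFDerivAt Ct (fderiv ℂ Ct ((0 : PBond P j → 𝔸), (0 : PBond P j → 𝔸))) ((0 : PBond P j → 𝔸), (0 : PBond P j → 𝔸)) := (han _ hmem0).differentiableAt.hasFDerivAt
  have hinnerB : HasFDerivAt (fun A : PBond P j → 𝔸 => ((A, B₀) : (PBond P j → 𝔸) × (PBond P j → 𝔸)))
      (ContinuousLinearMap.inl ℂ (PBond P j → 𝔸) (PBond P j → 𝔸)) 0 := hasFDerivAt_prodMk_left (0 : PBond P j → 𝔸) B₀
  have hinner0 : HasFDerivAt (fun A : PBond P j → 𝔸 => ((A, (0 : PBond P j → 𝔸)) : (PBond P j → 𝔸) × (PBond P j → 𝔸)))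
      (ContinuousLinearMap.inl ℂ (PBond P j → 𝔸) (PBond P j → 𝔸)) 0 := hasFDerivAt_prodMk_left (0 : PBond P j → 𝔸) (0 : PBond P j → 𝔸)
  have hsliceB : HasFDerivAt (fun A : PBond P j → 𝔸 => Ct (A, B₀))
      ((fderiv ℂ Ct ((0 : PBond P j → 𝔸), B₀)).comp (ContinuousLinearMap.inl ℂ (PBond P j → 𝔸) (PBond P j → 𝔸))) 0 :=
    HasFDerivAt.comp (f := fun A : PBond P j → 𝔸 => ((A, B₀) : (PBond P j → 𝔸) × (PBond P j → 𝔸))) (0 : PBond P j → 𝔸) hdB hinnerB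
  have hslice0 : HasFDerivAt (fun A : PBond P j → 𝔸 => Ct (A, 0))
      ((fderiv ℂ Ct ((0 : PBond P j → 𝔸), (0 : PBond P j → 𝔸))).comp (ContinuousLinearMap.inl ℂ (PBond P j → 𝔸) (PBond P j → 𝔸))) 0 :=
    HasFDerivAt.comp (f := fun A : PBond P j → 𝔸 => ((A, (0 : PBond P j → 𝔸)) : (PBond P j → 𝔸) × (PBond P j → 𝔸))) (0 : PBond P j → 𝔸)
      hd0 hinner0
  have hflat : (fun A : PBond P j → 𝔸 => Ct (A, 0)) = fun A => mlog ((dbarAvgU (fun b => expUnit (A b)) c : 𝔸ˣ) : 𝔸) := by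
    funext A; exact dbarJointChart_flat_bg c A
  have hsliceB_eq : (fun A : PBond P j → 𝔸 =>
      mlog (((dbarCovU (fun b => expUnit (B₀ b)) (fun b => expUnit (A b) * expUnit (B₀ b)) c : 𝔸ˣ) : 𝔸) *
        (((emlAvgU (fun b => expUnit (B₀ b)) c)⁻¹ : 𝔸ˣ) : 𝔸))) = fun A => Ct (A, B₀) := by
    funext A; rfl
  rw [hsliceB_eq, ← hflat, hsliceB.fderiv, hslice0.fderiv]
  have hzero : ((0 : PBond P j → 𝔸), (0 : PBond P j → 𝔸)) = (0 : (PBond P j → 𝔸) × (PBond P j → 𝔸)) := rfl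
  rw [hzero, ContinuousLinearMap.comp_apply, ContinuousLinearMap.comp_apply, ContinuousLinearMap.inl_apply, ← sub_apply]
  have hnY : ‖(Y, (0 : PBond P j → 𝔸))‖ = ‖Y‖ := by simp [Prod.norm_def]
  calc ‖(fderiv ℂ Ct ((0 : PBond P j → 𝔸), B₀) - fderiv ℂ Ct 0) (Y, 0)‖
      ≤ ‖fderiv ℂ Ct ((0 : PBond P j → 𝔸), B₀) - fderiv ℂ Ct 0‖ * ‖(Y, (0 : PBond P j → 𝔸))‖ := ContinuousLinearMap.le_opNorm _ _
    _ ≤ 16 * (12 * (P.L : ℝ) * ρ) / ρ ^ 2 * ‖B₀‖ * ‖Y‖ := by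
        rw [hnY]; exact mul_le_mul_of_nonneg_right hS (norm_nonneg _)

/-- **THE BACKGROUND SLICE IS DIFFERENTIABLE AT `0`** (so the `fderiv`s of §4 are honest derivatives), for `‖B₀‖ < ρ` under the budget.
[cite: Balaban1985Averaging, (125)-(127) p.36; Balaban1987RG1, (0.4) p.253] -/
theorem differentiableAt_dbarSlice_zero (hj : j + 1 ≤ P.m + P.K) (c : PBond P (j + 1)) {ρ : ℝ} (hρ0 : 0 < ρ)
    (hbudget : 10000000 * (((P.d + 2) * P.L : ℕ) : ℝ) ^ 2 * ρ ≤ 1)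
    (B₀ : PBond P j → 𝔸) (hB₀ : ‖B₀‖ < ρ) :
    DifferentiableAt ℂ (fun A : PBond P j → 𝔸 =>
      mlog (((dbarCovU (fun b => expUnit (B₀ b)) (fun b => expUnit (A b) * expUnit (B₀ b)) c : 𝔸ˣ) : 𝔸) *
        (((emlAvgU (fun b => expUnit (B₀ b)) c)⁻¹ : 𝔸ˣ) : 𝔸))) 0 := by
  have hnB : ‖((0 : PBond P j → 𝔸), B₀)‖ = ‖B₀‖ := by simp [Prod.norm_def]
  have han := analyticAt_dbarJointChart hj c hρ0.le hbudget ((0 : PBond P j → 𝔸), B₀) (by rw [hnB]; exact hB₀.le)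
  have hinnerB : HasFDerivAt (fun A : PBond P j → 𝔸 => ((A, B₀) : (PBond P j → 𝔸) × (PBond P j → 𝔸)))
      (ContinuousLinearMap.inl ℂ (PBond P j → 𝔸) (PBond P j → 𝔸)) 0 := hasFDerivAt_prodMk_left (0 : PBond P j → 𝔸) B₀
  have hcomp := HasFDerivAt.comp (f := fun A : PBond P j → 𝔸 => ((A, B₀) : (PBond P j → 𝔸) × (PBond P j → 𝔸))) (0 : PBond P j → 𝔸)
    han.differentiableAt.hasFDerivAt hinnerB
  exact hcomp.differentiableAt

/-- **THE FLAT DOUBLE-BAR CHART IS DIFFERENTIABLE AT `0`** (the budget at `ρ := (10⁷ℓ²)⁻¹`, slice at `B₀ = 0`). [cite: Balaban1985Averaging, (125) p.36; Balaban1987RG1, (0.4) p.253] -/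
theorem differentiableAt_dbarFlatChart_zero (hj : j + 1 ≤ P.m + P.K) (c : PBond P (j + 1)) :
    DifferentiableAt ℂ (fun A : PBond P j → 𝔸 => mlog ((dbarAvgU (fun b => expUnit (A b)) c : 𝔸ˣ) : 𝔸)) 0 := by
  set κ : ℝ := 10000000 * (((P.d + 2) * P.L : ℕ) : ℝ) ^ 2 with hκ
  have hℓ1 : (1 : ℝ) ≤ (((P.d + 2) * P.L : ℕ) : ℝ) := by
    exact_mod_cast Nat.one_le_iff_ne_zero.mpr (Nat.mul_ne_zero (by omega) (by have := P.hL.2; omega))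
  have hκ0 : 0 < κ := by rw [hκ]; positivity
  set ρ : ℝ := 1 / κ with hρ
  have hρ0 : 0 < ρ := by rw [hρ]; exact div_pos one_pos hκ0
  have hbudget : κ * ρ ≤ 1 := by rw [hρ, show κ * (1 / κ) = 1 by field_simp]
  have h := differentiableAt_dbarSlice_zero hj c hρ0 (by rw [← hκ]; exact hbudget) (0 : PBond P j → 𝔸) (by rw [norm_zero]; exact hρ0)
  have hflat : (fun A : PBond P j → 𝔸 =>
      mlog (((dbarCovU (fun b => expUnit ((0 : PBond P j → 𝔸) b)) (fun b => expUnit (A b) * expUnit ((0 : PBond P j → 𝔸) b)) c : 𝔸ˣ) : 𝔸) *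
        (((emlAvgU (fun b => expUnit ((0 : PBond P j → 𝔸) b)) c)⁻¹ : 𝔸ˣ) : 𝔸))) =
      fun A => mlog ((dbarAvgU (fun b => expUnit (A b)) c : 𝔸ˣ) : 𝔸) := by
    funext A; exact dbarJointChart_flat_bg c A
  rwa [hflat] at h

end Summit.QuantumFields.YangMills.Theorems.Prop7DbarJointAnalytic

end
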